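import Mathlib.LinearAlgebra.Matrix.SchurComplement
import Literature.Computability.AlgebraicComplexity.HopcroftKerrRowLemma
import Literature.Computability.AlgebraicComplexity.MatMulSandwichRect
import HarnessLib

/-!
# Hopcroft–Kerr's row lemma for row/column COMBINATIONS and for all three slots

Topic `Literature/Computability/AlgebraicComplexity` (bilinear complexity; lower bounds for small
matrix multiplication formats).  Everything in this file is PROVED over an arbitrary field; there
are no named facts and no new definitions.

`HopcroftKerrRowLemma.lean` proves Hopcroft–Kerr's Lemma 7 (Cornell CS TR 69-44 (1969) pp. 22–23
= SIAM J. Appl. Math. 20 (1971) 30–36) in the general row form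
`hopcroftKerr1971_lemma7_row`: for a decomposition `⟨m+1, p, n⟩ = ∑_{ρ ∈ σ} w_ρ ⊗ u_ρ ⊗ v_ρ`
and a set `D` of indices whose `X`-forms `u_ρ` are supported in one COORDINATE row `i₀`,
`R(⟨m, p, n⟩) + n + |D| ≤ |σ| + ⌊|D| / p⌋`, and the column companion `hopcroftKerr1971_lemma7_col`
(coordinate columns of the `X`-slot).  That file leaves as a TODO the printed scope of the lemma:
Hopcroft–Kerr state it for the products "of type `a₁₁α, a₁₂β, (a₁₁+a₁₂)γ`" and add (Corollary,
TR p. 23) "By transformations we also have similar theorems for `a₂₁α, a₂₂β, (a₂₁+a₂₂)γ` and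
`(a₁₁+a₂₁)α, (a₁₂+a₂₂)β, (a₁₁+a₁₂+a₂₁+a₂₂)γ`" — i.e. for the products reading only a fixed
row COMBINATION `xᵀA` (`x = e₁, e₂, e₁+e₂` over `GF(2)`).  This file supplies exactly those
transformations, in the tree's coordinates
`matMulTensor K k m n : (κ,ν) → (κ,μ) → (μ,ν) → K` (output `Z`, then `X`, then `Y`):

* (private helper `exists_isUnit_det_mulVec_eq_single`) — a nonzero vector is a coordinate vector
  up to `GL` (`P = 1 + (e_j − x)(x_j⁻¹ e_j)ᵀ`, `det P = x_j⁻¹`, `P x = e_j`).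
* `hopcroftKerr1971_lemma7_rowComb` — `X`-forms of ROW TYPE `u_ρ = x ⊗ y_ρ` (`x ∈ K^{m+1} ∖ 0`
  fixed: the form reads only `xᵀX`): `R(⟨m, p, n⟩) + n + |D| ≤ |σ| + ⌊|D| / p⌋`; from the
  coordinate-row theorem through the sandwich symmetry `X ↦ P X` (`sum_triad_sandwich_rect`,
  de Groote 1978 / Kauers–Moosbauer 2023 §2).
* `hopcroftKerr1971_lemma7_colComb` — `X`-forms of COLUMN TYPE `u_ρ = y_ρ ⊗ x` (`x ∈ K^{m+1} ∖ 0`):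
  `R(⟨m, k, n⟩) + n + |D| ≤ |σ| + ⌊|D| / k⌋` (sandwich `X ↦ X Qᵀ`).
* `matMulTensor_rotate_eq_sum` — a decomposition of `⟨k, m, n⟩` is a decomposition of `⟨m, n, k⟩`
  of the same length with the slots rotated (`(Z, X, Y) ↦ (Xᵀ, Y, Zᵀ)`; Bläser 2013 Lemma 5.5,
  tree `matMulTensor_rotate`), so the two theorems above apply to the `Y`- and `Z`-forms:
  `hopcroftKerr1971_lemma7_rowComb_Y` / `_colComb_Y` / `_rowComb_Z` / `_colComb_Z`.
* `⟨3,3,3⟩`: over every field `17 + |D| ≤ |σ| + ⌊|D| / 3⌋` for each of the six (slot, type)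
  readings and every nonzero `x ∈ K³` (`matMulTensor_three_card_le_X_row` …, from the tree's
  `R(⟨2,3,3⟩) ≥ 14`); and with `R(⟨2,3,3⟩) ≥ 15` (true over `𝔽₂`, Summits-side kernel theorem)
  and `|σ| ≤ 20`: **`|D| ≤ 3`** in all six readings (`matMulTensor_three_card_le_three_X_row` …).
  Over `𝔽₂` these are the `3 × (7 + 7) = 42` "HK7 caps" (7 row-type and 7 column-type 3-spaces
  per factor); plain substitution gives only `|D| ≤ 5`.

What is printed vs. typed: the printed Lemma 7 is `(m+1, p) = (2, 2)` over `GF(2)` with the three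
row combinations listed in the Corollary; the general format, the column type and the other two
slots are the same proof transported by the isotropy group (our extrapolation, kernel-checked
here, not a printed statement — as already said in `HopcroftKerrRowLemma.lean`).

## References

* [HopcroftKerr1971] J. E. Hopcroft, L. R. Kerr, *On minimizing the number of multiplications
  necessary for matrix multiplication*, SIAM J. Appl. Math. 20 (1971) 30–36; Cornell CS TR 69-44
  (1969), Lemma 7 and Corollary, pp. 22–23.
* [Degroote1978] H. F. de Groote, *On varieties of optimal algorithms for the computation of
  bilinear mappings I*, Theoret. Comput. Sci. 7 (1978) 1–24, §3 (sandwich symmetries).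
* [Blaser2013] M. Bläser, *Fast Matrix Multiplication*, Theory of Computing Graduate Surveys 5
  (2013), Lemma 5.5 (cyclic symmetry of `⟨k,m,n⟩`).
-/

noncomputable section

open scoped BigOperators Kronecker
open Matrix

namespace Literature.Computability.AlgebraicComplexity

namespace HopcroftKerrRow

variable {K : Type*} [Field K]

/-! ## §1 Transport tools -/

/-- A nonzero vector is a coordinate vector up to an invertible matrix: if `x ≠ 0` then for some
coordinate `j` (any one with `x_j ≠ 0`) the matrix `P = 1 + (e_j − x) · (x_j⁻¹ e_j)ᵀ` is invertible
(`det P = x_j⁻¹`, matrix determinant lemma) and `P x = e_j`. [folklore] -/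
private theorem exists_isUnit_det_mulVec_eq_single {k : ℕ} {x : Fin k → K} (hx : x ≠ 0) :
    ∃ (j : Fin k) (P : Matrix (Fin k) (Fin k) K), IsUnit P.det ∧ P *ᵥ x = Pi.single j 1 := by
  obtain ⟨j, hj⟩ : ∃ j, x j ≠ 0 := by
    by_contra h
    push Not at h
    exact hx (funext h)
  refine ⟨j, 1 + vecMulVec (Pi.single j 1 - x) ((x j)⁻¹ • Pi.single j 1), ?_, ?_⟩
  · rw [vecMulVec_eq (Fin 1), det_one_add_replicateCol_mul_replicateRow, smul_dotProduct,
      dotProduct_sub, single_dotProduct, single_dotProduct, one_mul, one_mul, Pi.single_eq_same,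
      smul_eq_mul]
    have h1 : (1 : K) + (x j)⁻¹ * (1 - x j) = (x j)⁻¹ := by
      field_simp
      ring
    rw [h1]
    exact isUnit_iff_ne_zero.2 (inv_ne_zero hj)
  · rw [add_mulVec, one_mulVec, vecMulVec_mulVec, smul_dotProduct, single_dotProduct, one_mul,
      smul_eq_mul, inv_mul_cancel₀ hj, MulOpposite.op_one, one_smul, add_sub_cancel]

/-- `(P ⊗ₖ Q)(x ⊗ y) = (P x) ⊗ (Q y)` on coordinate vectors. [folklore] -/
private theorem kronecker_mulVec_outer {k m : ℕ} (P : Matrix (Fin k) (Fin k) K)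
    (Q : Matrix (Fin m) (Fin m) K) (x : Fin k → K) (y : Fin m → K) :
    (P ⊗ₖ Q) *ᵥ (fun b : Fin k × Fin m => x b.1 * y b.2) =
      fun b : Fin k × Fin m => (P *ᵥ x) b.1 * (Q *ᵥ y) b.2 := by
  funext b
  simp only [mulVec, dotProduct]
  rw [Fintype.sum_prod_type, Finset.sum_mul_sum]
  refine Finset.sum_congr rfl fun κ _ => Finset.sum_congr rfl fun μ _ => ?_
  simp only [kroneckerMap_apply]
  ring

/-! ## §2 The `X`-slot: row and column combinations -/

/-- **Hopcroft–Kerr 1971, Lemma 7 with its Corollary — row COMBINATIONS.**  Let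
`⟨m+1, p, n⟩ = ∑_{ρ ∈ σ} w_ρ ⊗ u_ρ ⊗ v_ρ` (`0 < p`), `x ∈ K^{m+1}` nonzero, and `D` a set of indices
whose `X`-forms are of ROW TYPE `x`: `u_ρ = x ⊗ y_ρ` (the form reads only the row combination
`xᵀX`; printed: "multiplications of type `a₁₁α, a₁₂β, (a₁₁+a₁₂)γ`", and "by transformations …
similar theorems for `a₂₁α, …` and `(a₁₁+a₂₁)α, …`").  Then
`R(⟨m, p, n⟩) + n + |D| ≤ |σ| + ⌊|D| / p⌋`.  Proof: an invertible `P` with `P x = e_j`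
(`exists_isUnit_det_mulVec_eq_single`) and the sandwich symmetry `X ↦ P X`
(`sum_triad_sandwich_rect`) carry the decomposition to one of the same length whose counted
`X`-forms are supported in the coordinate row `j`; then `hopcroftKerr1971_lemma7_row`.
[cite: HopcroftKerr1971, Lemma 7 and Corollary] -/
theorem hopcroftKerr1971_lemma7_rowComb {m p n : ℕ} (hp : 0 < p) {σ : Type*} [Fintype σ]
    [DecidableEq σ] {w : σ → Fin (m + 1) × Fin n → K} {u : σ → Fin (m + 1) × Fin p → K}
    {v : σ → Fin p × Fin n → K}
    (ht : matMulTensor K (m + 1) p n = ∑ ρ, triad (w ρ) (u ρ) (v ρ))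
    {x : Fin (m + 1) → K} (hx : x ≠ 0) (D : Finset σ)
    (hD : ∀ ρ ∈ D, ∃ y : Fin p → K, u ρ = fun b => x b.1 * y b.2) :
    tensorRank (matMulTensor K m p n) + n + D.card ≤ Fintype.card σ + D.card / p := by
  obtain ⟨j, P, hP, hPx⟩ := exists_isUnit_det_mulVec_eq_single hx
  have h1p : IsUnit (1 : Matrix (Fin p) (Fin p) K).det := by rw [det_one]; exact isUnit_one
  have h1n : IsUnit (1 : Matrix (Fin n) (Fin n) K).det := by rw [det_one]; exact isUnit_one
  have ht' := sum_triad_sandwich_rect P 1 1 hP h1p h1n ht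
  refine hopcroftKerr1971_lemma7_row hp ht' j D fun ρ hρ b hb => ?_
  obtain ⟨y, hy⟩ := hD ρ hρ
  rw [hy, kronecker_mulVec_outer, hPx, one_mulVec]
  simp [hb]

/-- **Hopcroft–Kerr 1971, Lemma 7 — column COMBINATIONS of the `X`-slot.**  Let
`⟨k, m+1, n⟩ = ∑_{ρ ∈ σ} w_ρ ⊗ u_ρ ⊗ v_ρ` (`0 < k`), `x ∈ K^{m+1}` nonzero, and `D` a set of indices
whose `X`-forms are of COLUMN TYPE `x`: `u_ρ = y_ρ ⊗ x` (the form reads only the column combination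
`Xx`).  Then `R(⟨m, k, n⟩) + n + |D| ≤ |σ| + ⌊|D| / k⌋` (sandwich `X ↦ X Qᵀ` with `Q x = e_j`, then
`hopcroftKerr1971_lemma7_col`).  Hopcroft–Kerr print only row statements (`2 × 2` by `2 × n`);
the column type is the same proof through `(A,B,C) ↦ (Aᵀ,Cᵀ,Bᵀ)`.
[cite: HopcroftKerr1971, Lemma 7 and Corollary] -/
theorem hopcroftKerr1971_lemma7_colComb {k m n : ℕ} (hk : 0 < k) {σ : Type*} [Fintype σ]
    [DecidableEq σ] {w : σ → Fin k × Fin n → K} {u : σ → Fin k × Fin (m + 1) → K}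
    {v : σ → Fin (m + 1) × Fin n → K}
    (ht : matMulTensor K k (m + 1) n = ∑ ρ, triad (w ρ) (u ρ) (v ρ))
    {x : Fin (m + 1) → K} (hx : x ≠ 0) (D : Finset σ)
    (hD : ∀ ρ ∈ D, ∃ y : Fin k → K, u ρ = fun b => y b.1 * x b.2) :
    tensorRank (matMulTensor K m k n) + n + D.card ≤ Fintype.card σ + D.card / k := by
  obtain ⟨j, Q, hQ, hQx⟩ := exists_isUnit_det_mulVec_eq_single hx
  have h1k : IsUnit (1 : Matrix (Fin k) (Fin k) K).det := by rw [det_one]; exact isUnit_one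
  have h1n : IsUnit (1 : Matrix (Fin n) (Fin n) K).det := by rw [det_one]; exact isUnit_one
  have ht' := sum_triad_sandwich_rect 1 Q 1 h1k hQ h1n ht
  refine hopcroftKerr1971_lemma7_col hk ht' j D fun ρ hρ b hb => ?_
  obtain ⟨y, hy⟩ := hD ρ hρ
  rw [hy, kronecker_mulVec_outer, hQx, one_mulVec]
  simp [hb]

/-! ## §3 Rotating a decomposition: the `Y`- and `Z`-slots -/

/-- **A decomposition of `⟨k, m, n⟩` is a decomposition of `⟨m, n, k⟩` of the same length**, with
the slots rotated: `(Z, X, Y) ↦ (Xᵀ, Y, Zᵀ)` (the cyclic symmetry of matrix multiplication;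
tree `matMulTensor_rotate`). [cite: Blaser2013, Lemma 5.5 (proof, p. 22)] -/
theorem matMulTensor_rotate_eq_sum {k m n : ℕ} {σ : Type*} [Fintype σ]
    {w : σ → Fin k × Fin n → K} {u : σ → Fin k × Fin m → K} {v : σ → Fin m × Fin n → K}
    (ht : matMulTensor K k m n = ∑ ρ, triad (w ρ) (u ρ) (v ρ)) :
    matMulTensor K m n k = ∑ ρ, triad (fun a : Fin m × Fin k => u ρ a.swap) (v ρ)
      (fun c : Fin n × Fin k => w ρ c.swap) := by
  funext a b c
  have h := congrFun (congrFun (congrFun ht c.swap) a.swap) b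
  rw [matMulTensor_rotate K, Prod.swap_swap, Prod.swap_swap] at h
  rw [h]
  simp only [Finset.sum_apply, triad_apply]
  exact Finset.sum_congr rfl fun ρ _ => by ring

/-- **Row combinations of the `Y`-slot.**  Let `⟨k, m+1, n⟩ = ∑_{ρ ∈ σ} w_ρ ⊗ u_ρ ⊗ v_ρ` (`0 < n`),
`x ∈ K^{m+1}` nonzero, `D` a set of indices whose `Y`-forms are of row type `x`: `v_ρ = x ⊗ y_ρ`
(reads only `xᵀY`).  Then `R(⟨m, n, k⟩) + k + |D| ≤ |σ| + ⌊|D| / n⌋` (rotate, then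
`hopcroftKerr1971_lemma7_rowComb`). [cite: HopcroftKerr1971, Lemma 7 and Corollary] -/
theorem hopcroftKerr1971_lemma7_rowComb_Y {k m n : ℕ} (hn : 0 < n) {σ : Type*} [Fintype σ]
    [DecidableEq σ] {w : σ → Fin k × Fin n → K} {u : σ → Fin k × Fin (m + 1) → K}
    {v : σ → Fin (m + 1) × Fin n → K}
    (ht : matMulTensor K k (m + 1) n = ∑ ρ, triad (w ρ) (u ρ) (v ρ))
    {x : Fin (m + 1) → K} (hx : x ≠ 0) (D : Finset σ)
    (hD : ∀ ρ ∈ D, ∃ y : Fin n → K, v ρ = fun c => x c.1 * y c.2) :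
    tensorRank (matMulTensor K m n k) + k + D.card ≤ Fintype.card σ + D.card / n :=
  hopcroftKerr1971_lemma7_rowComb hn (matMulTensor_rotate_eq_sum ht) hx D hD

/-- **Column combinations of the `Y`-slot.**  Let `⟨k, m, n+1⟩ = ∑_{ρ ∈ σ} w_ρ ⊗ u_ρ ⊗ v_ρ`
(`0 < m`), `x ∈ K^{n+1}` nonzero, `D` a set of indices whose `Y`-forms are of column type `x`:
`v_ρ = y_ρ ⊗ x` (reads only `Yx`).  Then `R(⟨n, m, k⟩) + k + |D| ≤ |σ| + ⌊|D| / m⌋` (rotate, then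
`hopcroftKerr1971_lemma7_colComb`). [cite: HopcroftKerr1971, Lemma 7 and Corollary] -/
theorem hopcroftKerr1971_lemma7_colComb_Y {k m n : ℕ} (hm : 0 < m) {σ : Type*} [Fintype σ]
    [DecidableEq σ] {w : σ → Fin k × Fin (n + 1) → K} {u : σ → Fin k × Fin m → K}
    {v : σ → Fin m × Fin (n + 1) → K}
    (ht : matMulTensor K k m (n + 1) = ∑ ρ, triad (w ρ) (u ρ) (v ρ))
    {x : Fin (n + 1) → K} (hx : x ≠ 0) (D : Finset σ)
    (hD : ∀ ρ ∈ D, ∃ y : Fin m → K, v ρ = fun c => y c.1 * x c.2) :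
    tensorRank (matMulTensor K n m k) + k + D.card ≤ Fintype.card σ + D.card / m :=
  hopcroftKerr1971_lemma7_colComb hm (matMulTensor_rotate_eq_sum ht) hx D hD

/-- **Column combinations of the `Z`-slot (output forms).**  Let
`⟨k, m, n+1⟩ = ∑_{ρ ∈ σ} w_ρ ⊗ u_ρ ⊗ v_ρ` (`0 < k`), `x ∈ K^{n+1}` nonzero, `D` a set of indices whose
`Z`-forms are of column type `x`: `w_ρ = y_ρ ⊗ x` (`w_ρ (κ,ν) = y_ρ κ · x ν`).  Then
`R(⟨n, k, m⟩) + m + |D| ≤ |σ| + ⌊|D| / k⌋` (rotate twice: the `Z`-forms transposed become the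
`X`-forms of a decomposition of `⟨n+1, k, m⟩`, of row type `x`; then
`hopcroftKerr1971_lemma7_rowComb`). [cite: HopcroftKerr1971, Lemma 7 and Corollary] -/
theorem hopcroftKerr1971_lemma7_colComb_Z {k m n : ℕ} (hk : 0 < k) {σ : Type*} [Fintype σ]
    [DecidableEq σ] {w : σ → Fin k × Fin (n + 1) → K} {u : σ → Fin k × Fin m → K}
    {v : σ → Fin m × Fin (n + 1) → K}
    (ht : matMulTensor K k m (n + 1) = ∑ ρ, triad (w ρ) (u ρ) (v ρ))
    {x : Fin (n + 1) → K} (hx : x ≠ 0) (D : Finset σ)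
    (hD : ∀ ρ ∈ D, ∃ y : Fin k → K, w ρ = fun a => y a.1 * x a.2) :
    tensorRank (matMulTensor K n k m) + m + D.card ≤ Fintype.card σ + D.card / k :=
  hopcroftKerr1971_lemma7_rowComb hk (matMulTensor_rotate_eq_sum (matMulTensor_rotate_eq_sum ht))
    hx D fun ρ hρ => by
      obtain ⟨y, hy⟩ := hD ρ hρ
      exact ⟨y, funext fun b => by
        show w ρ b.swap = _
        rw [hy]
        simp only [Prod.fst_swap, Prod.snd_swap, mul_comm]⟩

/-- **Row combinations of the `Z`-slot (output forms).**  Let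
`⟨k+1, m, n⟩ = ∑_{ρ ∈ σ} w_ρ ⊗ u_ρ ⊗ v_ρ` (`0 < n`), `x ∈ K^{k+1}` nonzero, `D` a set of indices whose
`Z`-forms are of row type `x`: `w_ρ = x ⊗ y_ρ` (`w_ρ (κ,ν) = x κ · y_ρ ν`).  Then
`R(⟨k, n, m⟩) + m + |D| ≤ |σ| + ⌊|D| / n⌋` (rotate twice; the transposed `Z`-forms are of column
type `x`; then `hopcroftKerr1971_lemma7_colComb`). [cite: HopcroftKerr1971, Lemma 7 and Corollary] -/
theorem hopcroftKerr1971_lemma7_rowComb_Z {k m n : ℕ} (hn : 0 < n) {σ : Type*} [Fintype σ]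
    [DecidableEq σ] {w : σ → Fin (k + 1) × Fin n → K} {u : σ → Fin (k + 1) × Fin m → K}
    {v : σ → Fin m × Fin n → K}
    (ht : matMulTensor K (k + 1) m n = ∑ ρ, triad (w ρ) (u ρ) (v ρ))
    {x : Fin (k + 1) → K} (hx : x ≠ 0) (D : Finset σ)
    (hD : ∀ ρ ∈ D, ∃ y : Fin n → K, w ρ = fun a => x a.1 * y a.2) :
    tensorRank (matMulTensor K k n m) + m + D.card ≤ Fintype.card σ + D.card / n :=
  hopcroftKerr1971_lemma7_colComb hn (matMulTensor_rotate_eq_sum (matMulTensor_rotate_eq_sum ht))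
    hx D fun ρ hρ => by
      obtain ⟨y, hy⟩ := hD ρ hρ
      exact ⟨y, funext fun b => by
        show w ρ b.swap = _
        rw [hy]
        simp only [Prod.fst_swap, Prod.snd_swap, mul_comm]⟩

/-! ## §4 The six readings for `⟨3,3,3⟩` -/

section Three

variable {σ : Type*} [Fintype σ] [DecidableEq σ]
  {w : σ → Fin 3 × Fin 3 → K} {u : σ → Fin 3 × Fin 3 → K} {v : σ → Fin 3 × Fin 3 → K}

/-- `⟨3,3,3⟩`, every field, `X`-forms of row type `x ≠ 0`: `17 + |D| ≤ |σ| + ⌊|D|/3⌋` (from the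
tree's `R(⟨2,3,3⟩) ≥ 14`, Lafon–Winograd). [cite: HopcroftKerr1971, Lemma 7 and Corollary] -/
theorem matMulTensor_three_card_le_X_row
    (ht : matMulTensor K 3 3 3 = ∑ ρ, triad (w ρ) (u ρ) (v ρ)) {x : Fin 3 → K} (hx : x ≠ 0)
    (D : Finset σ) (hD : ∀ ρ ∈ D, ∃ y : Fin 3 → K, u ρ = fun b => x b.1 * y b.2) :
    17 + D.card ≤ Fintype.card σ + D.card / 3 := by
  have h := hopcroftKerr1971_lemma7_rowComb (m := 2) (p := 3) (n := 3) (by norm_num) ht hx D hD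
  have h14 := fourteen_le_tensorRank_matMulTensor_233 K
  omega

/-- `⟨3,3,3⟩`, every field, `X`-forms of column type `x ≠ 0`: `17 + |D| ≤ |σ| + ⌊|D|/3⌋`.
[cite: HopcroftKerr1971, Lemma 7 and Corollary] -/
theorem matMulTensor_three_card_le_X_col
    (ht : matMulTensor K 3 3 3 = ∑ ρ, triad (w ρ) (u ρ) (v ρ)) {x : Fin 3 → K} (hx : x ≠ 0)
    (D : Finset σ) (hD : ∀ ρ ∈ D, ∃ y : Fin 3 → K, u ρ = fun b => y b.1 * x b.2) :
    17 + D.card ≤ Fintype.card σ + D.card / 3 := by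
  have h := hopcroftKerr1971_lemma7_colComb (k := 3) (m := 2) (n := 3) (by norm_num) ht hx D hD
  have h14 := fourteen_le_tensorRank_matMulTensor_233 K
  omega

/-- `⟨3,3,3⟩`, every field, `Y`-forms of row type `x ≠ 0`: `17 + |D| ≤ |σ| + ⌊|D|/3⌋`.
[cite: HopcroftKerr1971, Lemma 7 and Corollary] -/
theorem matMulTensor_three_card_le_Y_row
    (ht : matMulTensor K 3 3 3 = ∑ ρ, triad (w ρ) (u ρ) (v ρ)) {x : Fin 3 → K} (hx : x ≠ 0)
    (D : Finset σ) (hD : ∀ ρ ∈ D, ∃ y : Fin 3 → K, v ρ = fun c => x c.1 * y c.2) :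
    17 + D.card ≤ Fintype.card σ + D.card / 3 := by
  have h := hopcroftKerr1971_lemma7_rowComb_Y (k := 3) (m := 2) (n := 3) (by norm_num) ht hx D hD
  have h14 := fourteen_le_tensorRank_matMulTensor_233 K
  omega

/-- `⟨3,3,3⟩`, every field, `Y`-forms of column type `x ≠ 0`: `17 + |D| ≤ |σ| + ⌊|D|/3⌋`.
[cite: HopcroftKerr1971, Lemma 7 and Corollary] -/
theorem matMulTensor_three_card_le_Y_col
    (ht : matMulTensor K 3 3 3 = ∑ ρ, triad (w ρ) (u ρ) (v ρ)) {x : Fin 3 → K} (hx : x ≠ 0)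
    (D : Finset σ) (hD : ∀ ρ ∈ D, ∃ y : Fin 3 → K, v ρ = fun c => y c.1 * x c.2) :
    17 + D.card ≤ Fintype.card σ + D.card / 3 := by
  have h := hopcroftKerr1971_lemma7_colComb_Y (k := 3) (m := 3) (n := 2) (by norm_num) ht hx D hD
  have h14 := fourteen_le_tensorRank_matMulTensor_233 K
  omega

/-- `⟨3,3,3⟩`, every field, `Z`-forms (outputs) of row type `x ≠ 0`: `17 + |D| ≤ |σ| + ⌊|D|/3⌋`.
[cite: HopcroftKerr1971, Lemma 7 and Corollary] -/
theorem matMulTensor_three_card_le_Z_row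
    (ht : matMulTensor K 3 3 3 = ∑ ρ, triad (w ρ) (u ρ) (v ρ)) {x : Fin 3 → K} (hx : x ≠ 0)
    (D : Finset σ) (hD : ∀ ρ ∈ D, ∃ y : Fin 3 → K, w ρ = fun a => x a.1 * y a.2) :
    17 + D.card ≤ Fintype.card σ + D.card / 3 := by
  have h := hopcroftKerr1971_lemma7_rowComb_Z (k := 2) (m := 3) (n := 3) (by norm_num) ht hx D hD
  have h14 := fourteen_le_tensorRank_matMulTensor_233 K
  omega

/-- `⟨3,3,3⟩`, every field, `Z`-forms (outputs) of column type `x ≠ 0`: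
`17 + |D| ≤ |σ| + ⌊|D|/3⌋`. [cite: HopcroftKerr1971, Lemma 7 and Corollary] -/
theorem matMulTensor_three_card_le_Z_col
    (ht : matMulTensor K 3 3 3 = ∑ ρ, triad (w ρ) (u ρ) (v ρ)) {x : Fin 3 → K} (hx : x ≠ 0)
    (D : Finset σ) (hD : ∀ ρ ∈ D, ∃ y : Fin 3 → K, w ρ = fun a => y a.1 * x a.2) :
    17 + D.card ≤ Fintype.card σ + D.card / 3 := by
  have h := hopcroftKerr1971_lemma7_colComb_Z (k := 3) (m := 3) (n := 2) (by norm_num) ht hx D hD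
  have h14 := fourteen_le_tensorRank_matMulTensor_233 K
  omega

/-- **The 42 caps for a hypothetical short scheme of `⟨3,3,3⟩`** (over `𝔽₂`: 7 nonzero `x` per
slot and type).  If `R(⟨2,3,3⟩) ≥ 15` over `K` (true over `𝔽₂`: Hopcroft–Kerr 1971 Thm 6; kernel
theorem `le_tensorRank_matMulTensor_233_gf2` on the Summits side) and `⟨3,3,3⟩` has a decomposition
of length `|σ| ≤ 20`, then for every nonzero `x ∈ K³` at most **3** terms have their `X`-form of
row type `x`. [cite: HopcroftKerr1971, Lemma 7 and Corollary] -/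
theorem matMulTensor_three_card_le_three_X_row (h15 : 15 ≤ tensorRank (matMulTensor K 2 3 3))
    (ht : matMulTensor K 3 3 3 = ∑ ρ, triad (w ρ) (u ρ) (v ρ)) (hσ : Fintype.card σ ≤ 20)
    {x : Fin 3 → K} (hx : x ≠ 0) (D : Finset σ)
    (hD : ∀ ρ ∈ D, ∃ y : Fin 3 → K, u ρ = fun b => x b.1 * y b.2) :
    D.card ≤ 3 := by
  have h := hopcroftKerr1971_lemma7_rowComb (m := 2) (p := 3) (n := 3) (by norm_num) ht hx D hD
  omega

/-- Same cap, `X`-forms of column type `x`. [cite: HopcroftKerr1971, Lemma 7 and Corollary] -/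
theorem matMulTensor_three_card_le_three_X_col (h15 : 15 ≤ tensorRank (matMulTensor K 2 3 3))
    (ht : matMulTensor K 3 3 3 = ∑ ρ, triad (w ρ) (u ρ) (v ρ)) (hσ : Fintype.card σ ≤ 20)
    {x : Fin 3 → K} (hx : x ≠ 0) (D : Finset σ)
    (hD : ∀ ρ ∈ D, ∃ y : Fin 3 → K, u ρ = fun b => y b.1 * x b.2) :
    D.card ≤ 3 := by
  have h := hopcroftKerr1971_lemma7_colComb (k := 3) (m := 2) (n := 3) (by norm_num) ht hx D hD
  omega

/-- Same cap, `Y`-forms of row type `x`. [cite: HopcroftKerr1971, Lemma 7 and Corollary] -/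
theorem matMulTensor_three_card_le_three_Y_row (h15 : 15 ≤ tensorRank (matMulTensor K 2 3 3))
    (ht : matMulTensor K 3 3 3 = ∑ ρ, triad (w ρ) (u ρ) (v ρ)) (hσ : Fintype.card σ ≤ 20)
    {x : Fin 3 → K} (hx : x ≠ 0) (D : Finset σ)
    (hD : ∀ ρ ∈ D, ∃ y : Fin 3 → K, v ρ = fun c => x c.1 * y c.2) :
    D.card ≤ 3 := by
  have h := hopcroftKerr1971_lemma7_rowComb_Y (k := 3) (m := 2) (n := 3) (by norm_num) ht hx D hD
  omega

/-- Same cap, `Y`-forms of column type `x`. [cite: HopcroftKerr1971, Lemma 7 and Corollary] -/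
theorem matMulTensor_three_card_le_three_Y_col (h15 : 15 ≤ tensorRank (matMulTensor K 2 3 3))
    (ht : matMulTensor K 3 3 3 = ∑ ρ, triad (w ρ) (u ρ) (v ρ)) (hσ : Fintype.card σ ≤ 20)
    {x : Fin 3 → K} (hx : x ≠ 0) (D : Finset σ)
    (hD : ∀ ρ ∈ D, ∃ y : Fin 3 → K, v ρ = fun c => y c.1 * x c.2) :
    D.card ≤ 3 := by
  have h := hopcroftKerr1971_lemma7_colComb_Y (k := 3) (m := 3) (n := 2) (by norm_num) ht hx D hD
  omega

/-- Same cap, `Z`-forms (outputs) of row type `x`. [cite: HopcroftKerr1971, Lemma 7 and Corollary] -/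
theorem matMulTensor_three_card_le_three_Z_row (h15 : 15 ≤ tensorRank (matMulTensor K 2 3 3))
    (ht : matMulTensor K 3 3 3 = ∑ ρ, triad (w ρ) (u ρ) (v ρ)) (hσ : Fintype.card σ ≤ 20)
    {x : Fin 3 → K} (hx : x ≠ 0) (D : Finset σ)
    (hD : ∀ ρ ∈ D, ∃ y : Fin 3 → K, w ρ = fun a => x a.1 * y a.2) :
    D.card ≤ 3 := by
  have h := hopcroftKerr1971_lemma7_rowComb_Z (k := 2) (m := 3) (n := 3) (by norm_num) ht hx D hD
  omega

/-- Same cap, `Z`-forms (outputs) of column type `x`. [cite: HopcroftKerr1971, Lemma 7 and Corollary] -/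
theorem matMulTensor_three_card_le_three_Z_col (h15 : 15 ≤ tensorRank (matMulTensor K 2 3 3))
    (ht : matMulTensor K 3 3 3 = ∑ ρ, triad (w ρ) (u ρ) (v ρ)) (hσ : Fintype.card σ ≤ 20)
    {x : Fin 3 → K} (hx : x ≠ 0) (D : Finset σ)
    (hD : ∀ ρ ∈ D, ∃ y : Fin 3 → K, w ρ = fun a => y a.1 * x a.2) :
    D.card ≤ 3 := by
  have h := hopcroftKerr1971_lemma7_colComb_Z (k := 3) (m := 3) (n := 2) (by norm_num) ht hx D hD
  omega

/-! ### The same caps one level up: `|σ| ≤ 21` gives `|D| ≤ 4` (the 42 "HK7 caps at `N = 21`")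

With `R(⟨2,3,3⟩) ≥ 15` and a decomposition of `⟨3,3,3⟩` of length `|σ| ≤ 21`, Lemma 7 (transported
as above) reads `15 + 3 + |D| ≤ 21 + ⌊|D|/3⌋`, i.e. `|D| − ⌊|D|/3⌋ ≤ 3`, i.e. **`|D| ≤ 4`** for every
nonzero `x` in each of the six (slot, type) readings — used by the cell pub-mm22 to discard, at
`N = 21`, every profile class with five or more `X`- (`Y`-, `Z`-) forms on one line of the grid.
Same proofs as the `≤ 3` corollaries; only the arithmetic changes. -/

/-- `|σ| ≤ 21`, `R(⟨2,3,3⟩) ≥ 15`: at most **4** terms have their `X`-form of row type `x`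
(`x ≠ 0` arbitrary). [cite: HopcroftKerr1971, Lemma 7 and Corollary] -/
theorem matMulTensor_three_card_le_four_X_row (h15 : 15 ≤ tensorRank (matMulTensor K 2 3 3))
    (ht : matMulTensor K 3 3 3 = ∑ ρ, triad (w ρ) (u ρ) (v ρ)) (hσ : Fintype.card σ ≤ 21)
    {x : Fin 3 → K} (hx : x ≠ 0) (D : Finset σ)
    (hD : ∀ ρ ∈ D, ∃ y : Fin 3 → K, u ρ = fun b => x b.1 * y b.2) :
    D.card ≤ 4 := by
  have h := hopcroftKerr1971_lemma7_rowComb (m := 2) (p := 3) (n := 3) (by norm_num) ht hx D hD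
  omega

/-- `|σ| ≤ 21`: at most `4` terms have their `X`-form of column type `x`.
[cite: HopcroftKerr1971, Lemma 7 and Corollary] -/
theorem matMulTensor_three_card_le_four_X_col (h15 : 15 ≤ tensorRank (matMulTensor K 2 3 3))
    (ht : matMulTensor K 3 3 3 = ∑ ρ, triad (w ρ) (u ρ) (v ρ)) (hσ : Fintype.card σ ≤ 21)
    {x : Fin 3 → K} (hx : x ≠ 0) (D : Finset σ)
    (hD : ∀ ρ ∈ D, ∃ y : Fin 3 → K, u ρ = fun b => y b.1 * x b.2) :
    D.card ≤ 4 := by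
  have h := hopcroftKerr1971_lemma7_colComb (k := 3) (m := 2) (n := 3) (by norm_num) ht hx D hD
  omega

/-- `|σ| ≤ 21`: at most `4` terms have their `Y`-form of row type `x`.
[cite: HopcroftKerr1971, Lemma 7 and Corollary] -/
theorem matMulTensor_three_card_le_four_Y_row (h15 : 15 ≤ tensorRank (matMulTensor K 2 3 3))
    (ht : matMulTensor K 3 3 3 = ∑ ρ, triad (w ρ) (u ρ) (v ρ)) (hσ : Fintype.card σ ≤ 21)
    {x : Fin 3 → K} (hx : x ≠ 0) (D : Finset σ)
    (hD : ∀ ρ ∈ D, ∃ y : Fin 3 → K, v ρ = fun c => x c.1 * y c.2) :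
    D.card ≤ 4 := by
  have h := hopcroftKerr1971_lemma7_rowComb_Y (k := 3) (m := 2) (n := 3) (by norm_num) ht hx D hD
  omega

/-- `|σ| ≤ 21`: at most `4` terms have their `Y`-form of column type `x`.
[cite: HopcroftKerr1971, Lemma 7 and Corollary] -/
theorem matMulTensor_three_card_le_four_Y_col (h15 : 15 ≤ tensorRank (matMulTensor K 2 3 3))
    (ht : matMulTensor K 3 3 3 = ∑ ρ, triad (w ρ) (u ρ) (v ρ)) (hσ : Fintype.card σ ≤ 21)
    {x : Fin 3 → K} (hx : x ≠ 0) (D : Finset σ)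
    (hD : ∀ ρ ∈ D, ∃ y : Fin 3 → K, v ρ = fun c => y c.1 * x c.2) :
    D.card ≤ 4 := by
  have h := hopcroftKerr1971_lemma7_colComb_Y (k := 3) (m := 3) (n := 2) (by norm_num) ht hx D hD
  omega

/-- `|σ| ≤ 21`: at most `4` terms have their `Z`-form (output) of row type `x`.
[cite: HopcroftKerr1971, Lemma 7 and Corollary] -/
theorem matMulTensor_three_card_le_four_Z_row (h15 : 15 ≤ tensorRank (matMulTensor K 2 3 3))
    (ht : matMulTensor K 3 3 3 = ∑ ρ, triad (w ρ) (u ρ) (v ρ)) (hσ : Fintype.card σ ≤ 21)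
    {x : Fin 3 → K} (hx : x ≠ 0) (D : Finset σ)
    (hD : ∀ ρ ∈ D, ∃ y : Fin 3 → K, w ρ = fun a => x a.1 * y a.2) :
    D.card ≤ 4 := by
  have h := hopcroftKerr1971_lemma7_rowComb_Z (k := 2) (m := 3) (n := 3) (by norm_num) ht hx D hD
  omega

/-- `|σ| ≤ 21`: at most `4` terms have their `Z`-form (output) of column type `x`.
[cite: HopcroftKerr1971, Lemma 7 and Corollary] -/
theorem matMulTensor_three_card_le_four_Z_col (h15 : 15 ≤ tensorRank (matMulTensor K 2 3 3))
    (ht : matMulTensor K 3 3 3 = ∑ ρ, triad (w ρ) (u ρ) (v ρ)) (hσ : Fintype.card σ ≤ 21)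
    {x : Fin 3 → K} (hx : x ≠ 0) (D : Finset σ)
    (hD : ∀ ρ ∈ D, ∃ y : Fin 3 → K, w ρ = fun a => y a.1 * x a.2) :
    D.card ≤ 4 := by
  have h := hopcroftKerr1971_lemma7_colComb_Z (k := 3) (m := 3) (n := 2) (by norm_num) ht hx D hD
  omega

end Three

end HopcroftKerrRow

end Literature.Computability.AlgebraicComplexity
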